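import Literature.MathematicalPhysics.QuantumManyBody.PeriodicClusteringFromKyFanGap
import Literature.MathematicalPhysics.QuantumManyBody.GroundStateDirichletForm
import Literature.MathematicalPhysics.QuantumManyBody.PeriodicFormSpectrum
import HarnessLib

/-!
# The Ky Fan two-level is finite whenever the ground-state energy is (`N ≥ 1`)
# (stub `stub_kyFanTwo_ne_top`, Q4 of the (α'₂) pair programme; line `third-law-current-floor`,
# crux `BECConjugateDomination.HardCoreExtension`, stmt-AtomisticToContinuum-11786)

For EVERY measurable pair-potential profile `v : ℝ → [0,∞]` (hard cores included), every `N ≥ 1` and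
`L > 0`: if `E₀ = periodicGroundStateEnergy v N L < ⊤` then `kyFanTwo v N L < ⊤`.

Proof. Pick a finite-energy trial state `Φ` and multiply it by the symmetrised plane wave
`P = ∑ⱼ e^{2πi x_{j,0}/L}` (`planeWaveSum L e₀`): `u = PΦ` is again `C¹`, periodic and Bose-symmetric, of
finite energy (`|∇(PΦ)|² ≤ 2|P|²|∇Φ|² + 2|Φ|²|∇P|²`, `|P| ≤ N`, `|∇P|² = N(2π/L)²`). The Gram–Schmidt
residual `g = u - ⟨Φ,u⟩Φ = (P - ⟨Φ,u⟩)Φ` does not vanish identically on the cell: otherwise `P` would be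
constant near a point of the open cell where `Φ ≠ 0`, contradicting `∂_{x_{0,0}} P = (2πi/L) e^{…} ≠ 0`.
Normalising `g` gives a trial state orthogonal to `Φ` of finite energy (parallelogram law for the energy
form), whence `kyFanTwo ≤ E[Φ] + E[g/‖g‖] < ⊤`. [folklore]
-/

noncomputable section

namespace Summit.AtomisticToContinuum.BoseEinsteinCondensation.Cruxes.HardCoreExtension.ThirdLawCurrentFloor

open MeasureTheory Filter
open scoped ENNReal NNReal BigOperators Topology ComplexConjugate
open Literature.MathematicalPhysics.QuantumManyBody.BoseGas

namespace KyFanTwoFinite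

variable {N : ℕ} {L : ℝ} {v : ℝ → ℝ≥0∞}

/-! ### The multiplied state `PΦ` has finite energy -/

/-- **Product rule bound for the kinetic density**: `|∇(ab)|² ≤ 2(|a|²|∇b|² + |b|²|∇a|²)` pointwise.
[folklore] -/
theorem kineticDensity_fun_mul_le {a b : Config N → ℂ} {X : Config N} (ha : DifferentiableAt ℝ a X)
    (hb : DifferentiableAt ℝ b X) :
    kineticDensity (fun Y => a Y * b Y) X ≤
      2 * (((‖a X‖₊ : ℝ≥0∞)) ^ 2 * kineticDensity b X + ((‖b X‖₊ : ℝ≥0∞)) ^ 2 * kineticDensity a X) := by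
  have hterm : ∀ w : Config N, ((‖fderiv ℝ (fun Y => a Y * b Y) X w‖₊ : ℝ≥0∞)) ^ 2 ≤
      2 * (((‖a X‖₊ : ℝ≥0∞)) ^ 2 * ((‖fderiv ℝ b X w‖₊ : ℝ≥0∞)) ^ 2 +
        ((‖b X‖₊ : ℝ≥0∞)) ^ 2 * ((‖fderiv ℝ a X w‖₊ : ℝ≥0∞)) ^ 2) := by
    intro w
    rw [fderiv_fun_mul ha hb, _root_.add_apply, _root_.smul_apply, _root_.smul_apply, smul_eq_mul,
      smul_eq_mul]
    calc ((‖a X * fderiv ℝ b X w + b X * fderiv ℝ a X w‖₊ : ℝ≥0∞)) ^ 2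
        ≤ 2 * (((‖a X * fderiv ℝ b X w‖₊ : ℝ≥0∞)) ^ 2 + ((‖b X * fderiv ℝ a X w‖₊ : ℝ≥0∞)) ^ 2) :=
          le_self_add.trans_eq (ennreal_sq_nnnorm_add_add_sub _ _)
      _ = _ := by rw [nnnorm_mul, nnnorm_mul, ENNReal.coe_mul, ENNReal.coe_mul, mul_pow, mul_pow]
  unfold kineticDensity
  calc _ ≤ ∑ i : Fin N, ∑ k : Fin 3, 2 * (((‖a X‖₊ : ℝ≥0∞)) ^ 2 *
        ((‖fderiv ℝ b X (Pi.single i (EuclideanSpace.single k (1 : ℝ)))‖₊ : ℝ≥0∞)) ^ 2 +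
        ((‖b X‖₊ : ℝ≥0∞)) ^ 2 *
        ((‖fderiv ℝ a X (Pi.single i (EuclideanSpace.single k (1 : ℝ)))‖₊ : ℝ≥0∞)) ^ 2) :=
        Finset.sum_le_sum fun i _ => Finset.sum_le_sum fun k _ => hterm _
    _ = _ := by simp only [Finset.mul_sum, Finset.sum_add_distrib, mul_add]

/-- `|P|² ≤ N²` for the symmetrised plane wave `P = planeWaveSum L n`. [folklore] -/
theorem coe_nnnorm_planeWaveSum_sq_le (L : ℝ) (n : Fin 3 → ℤ) (X : Config N) :
    ((‖planeWaveSum L n X‖₊ : ℝ≥0∞)) ^ 2 ≤ (N : ℝ≥0∞) ^ 2 := by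
  gcongr
  rw [← ENNReal.coe_natCast, ENNReal.coe_le_coe, ← NNReal.coe_le_coe, coe_nnnorm, NNReal.coe_natCast]
  exact norm_planeWaveSum_le L n X

/-- **Finite energy of `PΦ`**: for a trial state `Φ` of finite `v`-energy and a symmetrised plane wave
`P`, `q_v(PΦ) ≤ 2N² E_v[Φ] + 2N|2πn/L|² < ⊤`. [folklore] -/
theorem lintegral_energy_planeWaveSum_mul_lt_top (hv : Measurable v) (n : Fin 3 → ℤ)
    (Φ : PeriodicTrialState N L) (hΦ : periodicEnergy v Φ ≠ ⊤) :
    ∫⁻ X in cellN N L, kineticDensity (fun Y => planeWaveSum L n Y * Φ.ψ Y) X +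
        periodicInteraction v L X * ((‖planeWaveSum L n X * Φ.ψ X‖₊ : ℝ≥0∞)) ^ 2 < ⊤ := by
  set K : ℝ≥0∞ := (N : ℝ≥0∞) ^ 2 with hK
  set C : ℝ≥0∞ := N * ((‖latticeVec (2 * Real.pi / L) n‖₊ : ℝ≥0∞)) ^ 2 with hC
  have hPd : Differentiable ℝ (planeWaveSum (M := N) L n) :=
    (contDiff_planeWaveSum L n).differentiable one_ne_zero
  have hΦd : Differentiable ℝ Φ.ψ := Φ.contDiff.differentiable one_ne_zero
  have hpt : ∀ X, kineticDensity (fun Y => planeWaveSum L n Y * Φ.ψ Y) X +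
      periodicInteraction v L X * ((‖planeWaveSum L n X * Φ.ψ X‖₊ : ℝ≥0∞)) ^ 2 ≤
      2 * K * (kineticDensity Φ.ψ X + periodicInteraction v L X * ((‖Φ.ψ X‖₊ : ℝ≥0∞)) ^ 2) +
        2 * C * ((‖Φ.ψ X‖₊ : ℝ≥0∞)) ^ 2 := by
    intro X
    have hP2 := coe_nnnorm_planeWaveSum_sq_le (N := N) L n X
    have h1 : kineticDensity (fun Y => planeWaveSum L n Y * Φ.ψ Y) X ≤
        2 * (K * kineticDensity Φ.ψ X + ((‖Φ.ψ X‖₊ : ℝ≥0∞)) ^ 2 * C) := by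
      refine (kineticDensity_fun_mul_le (hPd X) (hΦd X)).trans ?_
      rw [kineticDensity_planeWaveSum]
      gcongr
    have h2 : ((‖planeWaveSum L n X * Φ.ψ X‖₊ : ℝ≥0∞)) ^ 2 ≤ K * ((‖Φ.ψ X‖₊ : ℝ≥0∞)) ^ 2 := by
      rw [nnnorm_mul, ENNReal.coe_mul, mul_pow]
      gcongr
    have h3 : periodicInteraction v L X * ((‖planeWaveSum L n X * Φ.ψ X‖₊ : ℝ≥0∞)) ^ 2 ≤
        2 * (periodicInteraction v L X * (K * ((‖Φ.ψ X‖₊ : ℝ≥0∞)) ^ 2)) :=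
      calc _ ≤ periodicInteraction v L X * (K * ((‖Φ.ψ X‖₊ : ℝ≥0∞)) ^ 2) := by gcongr
        _ ≤ _ := le_mul_of_one_le_left zero_le one_le_two
    calc _ ≤ 2 * (K * kineticDensity Φ.ψ X + ((‖Φ.ψ X‖₊ : ℝ≥0∞)) ^ 2 * C) +
          2 * (periodicInteraction v L X * (K * ((‖Φ.ψ X‖₊ : ℝ≥0∞)) ^ 2)) := add_le_add h1 h3
      _ = _ := by ring
  have hmΦ := measurable_energyIntegrand hv L Φ.contDiff.continuous
  have hm2 := measurable_coe_nnnorm_sq Φ.contDiff.continuous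
  have hK' : K ≠ ⊤ := ENNReal.pow_ne_top (ENNReal.natCast_ne_top N)
  have hC' : C ≠ ⊤ :=
    ENNReal.mul_ne_top (ENNReal.natCast_ne_top N) (ENNReal.pow_ne_top ENNReal.coe_ne_top)
  have hΦ' : ∫⁻ X in cellN N L, kineticDensity Φ.ψ X +
      periodicInteraction v L X * ((‖Φ.ψ X‖₊ : ℝ≥0∞)) ^ 2 ≠ ⊤ := hΦ
  calc _ ≤ ∫⁻ X in cellN N L, 2 * K * (kineticDensity Φ.ψ X +
        periodicInteraction v L X * ((‖Φ.ψ X‖₊ : ℝ≥0∞)) ^ 2) + 2 * C * ((‖Φ.ψ X‖₊ : ℝ≥0∞)) ^ 2 :=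
        lintegral_mono hpt
    _ = 2 * K * (∫⁻ X in cellN N L, kineticDensity Φ.ψ X +
        periodicInteraction v L X * ((‖Φ.ψ X‖₊ : ℝ≥0∞)) ^ 2) + 2 * C := by
        rw [lintegral_add_left (hmΦ.const_mul _), lintegral_const_mul _ hmΦ, lintegral_const_mul _ hm2,
          Φ.norm_eq, mul_one]
    _ < ⊤ := ENNReal.add_lt_top.2 ⟨ENNReal.mul_lt_top (ENNReal.mul_lt_top ENNReal.ofNat_lt_top
        hK'.lt_top) hΦ'.lt_top, ENNReal.mul_lt_top ENNReal.ofNat_lt_top hC'.lt_top⟩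

/-! ### Non-degeneracy: `PΦ` is not parallel to `Φ` -/

/-- A normalised trial state does not vanish identically on the OPEN cell `(0,L)^{3N}` (every point of
`[0,L)^{3N}` is a limit of points of the open cell along `t ↦ X + t(1,…,1)`, `t ↓ 0`). [folklore] -/
theorem exists_mem_openCell_ne_zero (Φ : PeriodicTrialState N L) :
    ∃ X : Config N, (∀ i a, X i a ∈ Set.Ioo 0 L) ∧ Φ.ψ X ≠ 0 := by
  by_contra h
  push Not at h
  have hzero : ∀ X ∈ cellN N L, Φ.ψ X = 0 := by
    intro X hX
    set E : Config N := fun _ => WithLp.toLp 2 fun _ : Fin 3 => (1 : ℝ) with hE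
    have hcont : Tendsto (fun t : ℝ => Φ.ψ (X + t • E)) (𝓝[>] 0) (𝓝 (Φ.ψ X)) := by
      have hc : Continuous fun t : ℝ => Φ.ψ (X + t • E) := Φ.contDiff.continuous.comp (by fun_prop)
      have h0 := hc.tendsto 0
      rw [zero_smul, add_zero] at h0
      exact h0.mono_left nhdsWithin_le_nhds
    have hev : ∀ᶠ t in 𝓝[>] (0 : ℝ), Φ.ψ (X + t • E) = 0 := by
      have hin : ∀ᶠ t in 𝓝[>] (0 : ℝ), ∀ i a, (X + t • E) i a ∈ Set.Ioo 0 L := by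
        refine eventually_all.2 fun i => eventually_all.2 fun a => ?_
        have hXia : X i a ∈ Set.Ico 0 L := hX i a
        filter_upwards [Ioo_mem_nhdsGT (sub_pos.2 hXia.2)] with t ht
        simp only [hE, Pi.add_apply, Pi.smul_apply, PiLp.add_apply, PiLp.smul_apply, smul_eq_mul, mul_one,
          Set.mem_Ioo]
        exact ⟨by linarith [hXia.1, ht.1], by linarith [ht.2]⟩
      exact hin.mono fun t ht => h _ ht
    exact (tendsto_const_nhds_iff.1 (hcont.congr' hev)).symm
  have h1 := Φ.norm_eq
  rw [setLIntegral_congr_fun (g := fun _ => 0) (measurableSet_cellN N L)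
    (fun X hX => by simp [hzero X hX]), lintegral_zero] at h1
  exact zero_ne_one h1

/-- The open cell `(0,L)^{3N}` is open. [folklore] -/
theorem isOpen_openCell (N : ℕ) (L : ℝ) : IsOpen {X : Config N | ∀ i a, X i a ∈ Set.Ioo 0 L} := by
  have hrw : {X : Config N | ∀ i a, X i a ∈ Set.Ioo 0 L} =
      ⋂ i, ⋂ a, (fun X : Config N => X i a) ⁻¹' Set.Ioo 0 L := by
    ext X; simp
  rw [hrw]
  exact isOpen_iInter_of_finite fun i => isOpen_iInter_of_finite fun a =>
    isOpen_Ioo.preimage (by fun_prop)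

/-- **Non-degeneracy.** For `L > 0`, `N ≥ 1`, a trial state `Φ`, any `α ∈ ℂ` and `n ∈ ℤ³` with `n₀ ≠ 0`,
the function `(P - α)Φ`, `P = planeWaveSum L n`, has non-zero `L²(cell)` norm: otherwise `P = α` near a
point of the open cell where `Φ ≠ 0`, so `∂_{x_{0,0}}P = 0` there, contradicting
`∂_{x_{0,0}}P = (2πi n₀/L) e^{2πi n·x₀/L} ≠ 0`. [folklore] -/
theorem lintegral_sq_planeWaveSum_mul_sub_ne_zero (hL : 0 < L) (hN : 1 ≤ N) (Φ : PeriodicTrialState N L)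
    (α : ℂ) {n : Fin 3 → ℤ} (hn : n 0 ≠ 0) :
    ∫⁻ X in cellN N L, ((‖planeWaveSum L n X * Φ.ψ X - α * Φ.ψ X‖₊ : ℝ≥0∞)) ^ 2 ≠ 0 := by
  obtain ⟨X₁, hX₁, hΦ₁⟩ := exists_mem_openCell_ne_zero Φ
  intro h0
  -- the residual vanishes on the open cell
  have hg : ∀ X : Config N, (∀ i a, X i a ∈ Set.Ioo 0 L) →
      planeWaveSum L n X * Φ.ψ X - α * Φ.ψ X = 0 := by
    intro X hX
    by_contra hne
    exact (lintegral_cellN_pos (Φ := fun Y => planeWaveSum L n Y * Φ.ψ Y - α * Φ.ψ Y)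
      (((contDiff_planeWaveSum L n).continuous.mul Φ.contDiff.continuous).sub
        (continuous_const.mul Φ.contDiff.continuous)) hX hne).ne' h0
  -- hence `P = α` near `X₁`
  have hev : planeWaveSum (M := N) L n =ᶠ[𝓝 X₁] fun _ => α := by
    filter_upwards [(isOpen_openCell N L).mem_nhds hX₁,
      Φ.contDiff.continuous.continuousAt.eventually_ne hΦ₁] with Y hY hΦY
    exact mul_right_cancel₀ hΦY (sub_eq_zero.1 (hg Y hY))
  have hfd := fderiv_planeWaveSum_apply_single L n X₁ ⟨0, hN⟩ 0
  rw [hev.fderiv_eq, fderiv_const_apply, _root_.zero_apply] at hfd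
  refine (mul_ne_zero (div_ne_zero (mul_ne_zero (mul_ne_zero (mul_ne_zero two_ne_zero ?_)
    Complex.I_ne_zero) ?_) ?_) ?_) hfd.symm
  · exact Complex.ofReal_ne_zero.2 Real.pi_ne_zero
  · exact Int.cast_ne_zero.2 hn
  · exact Complex.ofReal_ne_zero.2 hL.ne'
  · rw [← norm_ne_zero_iff, norm_cellWave]; exact one_ne_zero

/-! ### Gram–Schmidt with finite energy -/

/-- **Gram–Schmidt step.** Given a trial state `Φ` of finite `v`-energy and a `C¹` periodic Bose-symmetric
`u` of finite `v`-energy whose residual `u - ⟨Φ,u⟩Φ` has non-zero `L²(cell)` norm, the normalised residual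
is a trial state orthogonal to `Φ` of finite `v`-energy (parallelogram law for the energy form). [folklore] -/
theorem exists_orthogonal_finiteEnergy (hv : Measurable v) (Φ : PeriodicTrialState N L)
    (hΦ : periodicEnergy v Φ ≠ ⊤) {u : Config N → ℂ} (huC : ContDiff ℝ 1 u)
    (hper : ∀ (X : Config N) (i : Fin N) (k : Fin 3), u (X + Pi.single i (EuclideanSpace.single k L)) = u X)
    (hsymm : ∀ (σ : Equiv.Perm (Fin N)) (X : Config N), u (X ∘ σ) = u X)
    (hqu : ∫⁻ X in cellN N L, kineticDensity u X +
      periodicInteraction v L X * ((‖u X‖₊ : ℝ≥0∞)) ^ 2 ≠ ⊤)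
    (h0 : ∫⁻ X in cellN N L,
      ((‖u X - (∫ Y in cellN N L, conj (Φ.ψ Y) * u Y) * Φ.ψ X‖₊ : ℝ≥0∞)) ^ 2 ≠ 0) :
    ∃ Ψ₂ : PeriodicTrialState N L, (∫ X in cellN N L, conj (Φ.ψ X) * Ψ₂.ψ X = 0) ∧
      periodicEnergy v Ψ₂ ≠ ⊤ := by
  set α : ℂ := ∫ Y in cellN N L, conj (Φ.ψ Y) * u Y with hα
  have hΦc : Continuous Φ.ψ := Φ.contDiff.continuous
  have hαΦC : ContDiff ℝ 1 (fun X => α * Φ.ψ X) := contDiff_const.mul Φ.contDiff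
  have hgC : ContDiff ℝ 1 (fun X => u X - α * Φ.ψ X) := huC.sub hαΦC
  have hg_per : ∀ (X : Config N) (i : Fin N) (k : Fin 3),
      u (X + Pi.single i (EuclideanSpace.single k L)) -
        α * Φ.ψ (X + Pi.single i (EuclideanSpace.single k L)) = u X - α * Φ.ψ X :=
    fun X i k => by rw [hper, Φ.periodic]
  have hg_symm : ∀ (σ : Equiv.Perm (Fin N)) (X : Config N),
      u (X ∘ σ) - α * Φ.ψ (X ∘ σ) = u X - α * Φ.ψ X := fun σ X => by rw [hsymm, Φ.symm]
  have hgtop : ∫⁻ X in cellN N L, ((‖u X - α * Φ.ψ X‖₊ : ℝ≥0∞)) ^ 2 ≠ ⊤ :=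
    (lintegral_cellN_sq_lt_top L hgC.continuous).ne
  obtain ⟨Ψ₂, a, hΨ₂, -⟩ := exists_periodicTrialState_const_mul hgC hg_per hg_symm h0 hgtop
  refine ⟨Ψ₂, ?_, ?_⟩
  · -- orthogonality: `⟨Φ, a(u - αΦ)⟩ = a(α - α) = 0`
    rw [hΨ₂]
    have hprod : (fun X => conj (Φ.ψ X) * ((a : ℂ) * (u X - α * Φ.ψ X))) =
        fun X => (a : ℂ) * (conj (Φ.ψ X) * u X) - (a : ℂ) * α * (conj (Φ.ψ X) * Φ.ψ X) := by
      funext X; ring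
    have hi1 : IntegrableOn (fun X => (a : ℂ) * (conj (Φ.ψ X) * u X)) (cellN N L) :=
      integrableOn_cellN_of_continuous L (continuous_const.mul (hΦc.star.mul huC.continuous))
    have hi2 : IntegrableOn (fun X => (a : ℂ) * α * (conj (Φ.ψ X) * Φ.ψ X)) (cellN N L) :=
      integrableOn_cellN_of_continuous L (continuous_const.mul (hΦc.star.mul hΦc))
    show ∫ X in cellN N L, conj (Φ.ψ X) * ((a : ℂ) * (u X - α * Φ.ψ X)) = 0
    rw [hprod, integral_sub hi1 hi2, integral_const_mul, integral_const_mul,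
      integral_cellN_conj_mul_self_trialState, ← hα]
    ring
  · -- energy: `E[Ψ₂] = |a|² q(u - αΦ) ≤ |a|² (2q(u) + 2|α|² E[Φ]) < ⊤`
    have hpar := lintegral_periodicEnergy_add_add_sub hv L huC hαΦC
    have hqg : ∫⁻ X in cellN N L, kineticDensity (fun Y => u Y - α * Φ.ψ Y) X +
        periodicInteraction v L X * ((‖u X - α * Φ.ψ X‖₊ : ℝ≥0∞)) ^ 2 ≤
        2 * (∫⁻ X in cellN N L, kineticDensity u X +
          periodicInteraction v L X * ((‖u X‖₊ : ℝ≥0∞)) ^ 2) +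
        2 * (∫⁻ X in cellN N L, kineticDensity (fun Y => α * Φ.ψ Y) X +
          periodicInteraction v L X * ((‖α * Φ.ψ X‖₊ : ℝ≥0∞)) ^ 2) :=
      hpar ▸ le_add_self
    have hqαΦ := lintegral_periodicEnergy_const_mul v L α Φ.contDiff
    have hΦ' : ∫⁻ X in cellN N L, kineticDensity Φ.ψ X +
        periodicInteraction v L X * ((‖Φ.ψ X‖₊ : ℝ≥0∞)) ^ 2 ≠ ⊤ := hΦ
    unfold periodicEnergy
    rw [hΨ₂, lintegral_periodicEnergy_const_mul v L (a : ℂ) hgC]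
    refine ENNReal.mul_ne_top (ENNReal.pow_ne_top ENNReal.coe_ne_top) (ne_top_of_le_ne_top ?_ hqg)
    rw [hqαΦ]
    exact ENNReal.add_ne_top.2 ⟨ENNReal.mul_ne_top ENNReal.ofNat_ne_top hqu,
      ENNReal.mul_ne_top ENNReal.ofNat_ne_top
        (ENNReal.mul_ne_top (ENNReal.pow_ne_top ENNReal.coe_ne_top) hΦ')⟩

end KyFanTwoFinite

open KyFanTwoFinite

/-- **Q4 `stub_kyFanTwo_ne_top`** (the Ky Fan two-level is finite whenever the ground-state energy is,
`N ≥ 1`; every measurable `v`, hard cores included). Proof: a finite-energy state `Φ` and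
`u = (planeWaveSum L e₀)·Φ` are linearly independent in `L²(cell)` (else the trigonometric sum would be
constant on an open set where `Φ ≠ 0`; differentiate in one particle coordinate), both of finite energy
(`|∇(PΦ)|² ≤ 2N²|∇Φ|² + 2|∇P|²|Φ|²`); Gram–Schmidt gives an admissible orthogonal pair. [folklore] -/
theorem stub_kyFanTwo_ne_top :
    ∀ (v : ℝ → ℝ≥0∞), Measurable v → ∀ (N : ℕ) (L : ℝ), 0 < L → 1 ≤ N →
      periodicGroundStateEnergy v N L ≠ ⊤ → kyFanTwo v N L ≠ ⊤ := by
  intro v hv N L hL hN hE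
  -- (0) a trial state of finite energy
  obtain ⟨Φ, hΦ⟩ := iInf_lt_top.1 (lt_top_iff_ne_top.2 hE)
  -- (1) the multiplied state `u = PΦ`, `P = ∑ⱼ e^{2πi x_{j,0}/L}`
  set n : Fin 3 → ℤ := Pi.single 0 1 with hn
  have hn0 : n 0 ≠ 0 := by simp [hn]
  have huC : ContDiff ℝ 1 (fun X => planeWaveSum L n X * Φ.ψ X) :=
    (contDiff_planeWaveSum L n).mul Φ.contDiff
  have hper : ∀ (X : Config N) (i : Fin N) (k : Fin 3),
      planeWaveSum L n (X + Pi.single i (EuclideanSpace.single k L)) *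
          Φ.ψ (X + Pi.single i (EuclideanSpace.single k L)) = planeWaveSum L n X * Φ.ψ X :=
    fun X i k => by rw [planeWaveSum_periodic hL.ne', Φ.periodic]
  have hsymm : ∀ (σ : Equiv.Perm (Fin N)) (X : Config N),
      planeWaveSum L n (X ∘ σ) * Φ.ψ (X ∘ σ) = planeWaveSum L n X * Φ.ψ X :=
    fun σ X => by rw [planeWaveSum_symm, Φ.symm]
  have hqu := lintegral_energy_planeWaveSum_mul_lt_top hv n Φ hΦ.ne
  -- (2)+(3) non-degeneracy and Gram–Schmidt
  obtain ⟨Ψ₂, horth, hE2⟩ := exists_orthogonal_finiteEnergy hv Φ hΦ.ne huC hper hsymm hqu.ne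
    (lintegral_sq_planeWaveSum_mul_sub_ne_zero hL hN Φ _ hn0)
  -- (4) the Ky Fan level is at most `E[Φ] + E[Ψ₂] < ⊤`
  refine ne_top_of_le_ne_top (ENNReal.add_ne_top.2 ⟨hΦ.ne, hE2⟩) ?_
  unfold kyFanTwo
  exact iInf_le_of_le Φ (iInf_le_of_le Ψ₂ (iInf_le_of_le horth le_rfl))

end Summit.AtomisticToContinuum.BoseEinsteinCondensation.Cruxes.HardCoreExtension.ThirdLawCurrentFloor

end
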